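import Summits.Ventures.LatticeQCDFlow.Scaling.StarConveyorRotation
import Summits.Ventures.LatticeQCDFlow.Scaling.FlowHubTauInt

/-!
HONEST FRAMING: exact (Metropolis-corrected) sampling algorithms for lattice gauge theory; figures
of merit are autocorrelation/cost numbers at stated couplings and volumes; no continuum-physics
claim.

# OneSidedHubFloor — THE LINEAR LAW UNDER ONE-SIDED DOMINATION: IF THE HOT LAW DOMINATES EVERY COLD LAW POINTWISE UP
# TO `p` (`p·μ_{k+1} ≤ μ_0`, NOTHING THE OTHER WAY), THE WEIGHTED HUB SCHEME HAS
# `Gap ≥ p·min{t/(6m), γ₀(1−t)w_0/(14K)}`; HOT-ONLY STAR `Gap ≥ p·min{t, γ₀(1−t)}/(14K)`; WITH MAPS THE SAME UNDER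
# TRANSPORTED DOMINATION `p·μ_{k+1}(φ_k u) ≤ μ_0(u)`, IN PARTICULAR FOR SECTOR-REWEIGHTED TRANSPORTS
# `μ_{k+1}∘φ_k = (r_k∘mode)·μ_0` WITH `p·r_k ≤ 1`: THE LINEAR LAW ACROSS A ONE-SIDED SECTOR-WEIGHT BARRIER
# (lean-2 GEN-22, ours)

Venture-side (OURS).  Cell `lqcd-flow` (pub-lqcd), unit `pub-lqcd-lean-2-g22`, 2026-08-26.  Chapter J, file 8: the
star conveyor of `Scaling/StarConveyorRotation` (J1) run AT THE CONFIGURATION LEVEL (`J := S`, `ν := μ`, `Q :=` the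
weighted hub scheme `P = t·ptGraphSwap μ e 1 + (1−t)·prodKernel w M` of `Scaling/WeightedHubSchemeFloor` (I1), `Q₀ :=`
the hot update `M_0`): its hypotheses are exactly I1's flow formulas `whub_swap_flow_ge` (`κ = t/m`) and
`whub_hot_flow_ge` (`θ = (1−t)w_0`), the hot update's Poincaré constant `γ₀`, and — in place of I1's TWO-SIDED ratio
`r·μ_0 ≤ μ_{k+1} ≤ μ_0/r` (floor `1/(3m(r²+1)/(tr⁴) + (r³+3K)/(r³γ₀(1−t)w_0))`) — the ONE-SIDED pointwise domination
`p·μ_{k+1}(u) ≤ μ_0(u)`: the hot law may put arbitrarily MORE weight than a cold law anywhere (a sector that empties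
at the cold levels), never less than the fraction `p`.  Rotation paths (relabel the hot replica to the target
configuration, swap it to the cold level, relabel the hot replica back) move only configurations drawn from COLD
laws through the hot position, which the hot law dominates; I1's path (swap first) moved cold configurations' hot
partners to the cold level and needed the reverse bound.

## What is proved

* §1 **`oneSidedHub_poincare`** (`C·Var_π̃ ≤ 𝓔_π̃(P)` for `C·6m ≤ pt`, `C·2(p+6K) ≤ pγ₀(1−t)w_0`),
  **`oneSidedHub_spectralGap_ge`** (`Gap ≥ p·min{t/(6m), γ₀(1−t)w_0/(14K)}`; swap graph of `m` edges with distinct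
  endpoints, identity maps, containing the hub; `w_0 > 0`; cold updates arbitrary `μ_k`-reversible).
* §2 **`oneSidedHotOnlyStar_spectralGap_two_sided`** — star, `w = 𝟙_{k=0}`:
  `p·min{t, γ₀(1−t)}/(14K) ≤ Gap ≤ t·min{μ_0(A), μ_0(Aᶜ)}/(Kv)` (the ceiling of `Scaling/ExchangeSchemeHandoverCeiling`,
  any sector `A` with `μ_k(A)μ_k(Aᶜ) ≥ v` at the cold levels) — THE LINEAR LAW, one-sided.
* §3 maps on the hub edges (`Scaling/FlowHubSchemeFloor`'s level coordinates): **`oneSidedFlowStar_spectralGap_ge`**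
  under transported domination `p·μ_{k+1}(φ_k u) ≤ μ_0(u)`; **`flowStarReweighted_spectralGap_ge_linear`** —
  SECTOR-REWEIGHTED TRANSPORTS `μ_{k+1}(φ_k u) = r_k(mode u)·μ_0(u)` with `p·r_k(j) ≤ 1` (each map carries every
  sector's hot conditional law onto the cold conditional law; the cold sector WEIGHTS are at most `1/p` times the hot
  ones, and may be arbitrarily smaller), hot-only updates: `Gap ≥ p·min{t, γ₀(1−t)}/(14K)`;
  **`flowStarReweighted_tauInt_le`** — `τ_int(g) ≤ 14K/(p·min{t, γ₀(1−t)}) − ½` for every observable.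

Reading (no numerics implied): the order-`K` law of the hub survives a one-sided sector-weight barrier at full
strength — a cold level may suppress a topological sector by any factor, as long as no sector is RARER at the hot
level than at the cold ones by more than `1/p`, and the maps match the conditional shapes; compare the `K⁻²` floors
of `Scaling/HubModeGap` / `Scaling/HubModeTransport` (J3/J5), which need no pointwise domination but within-sector
relaxation of the cold updates.  NOT CLAIMED: anything when the hot law fails to dominate (cold laws more
concentrated than the hot law inside a sector and no map to undo it: then J3/J5 or the ladders); continuous spaces;
anything measured.  Literature grade (cell rule): OWN MECHANISM (J1 at the configuration level), NEW TYPING; nothing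
cited as a fact; no new bib keys.
-/

noncomputable section

open Finset Function
open Literature.Probability.MarkovChains

namespace Summit.Ventures.LatticeQCDFlow.Scaling

section OneSided

variable {S J : Type*} [Fintype S] [DecidableEq S] {K m : ℕ} {μ : Fin (K + 1) → S → ℝ}
  {M : Fin (K + 1) → S → S → ℝ} {w : Fin (K + 1) → ℝ} {t : ℝ} {e : Fin m → Fin (K + 1) × Fin (K + 1)}

/-! ## §1 The weighted hub scheme under one-sided domination -/

/-- **THE ONE-SIDED HUB POINCARÉ INEQUALITY:** swap graph `e` of `m ≥ 1` edges (distinct endpoints, identity maps)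
containing every hub edge `(0, k+1)`, weights `w ≥ 0` with `Σw = 1`, `0 ≤ t ≤ 1`, hot Poincaré constant `γ₀`, and
ONE-SIDED domination `p·μ_{k+1}(u) ≤ μ_0(u)`: `C·Var_π̃(f) ≤ 𝓔_π̃(P; f)` whenever `C·6m ≤ pt` and
`C·2(p+6K) ≤ pγ₀(1−t)w_0`. [ours] -/
theorem oneSidedHub_poincare (hm : 1 ≤ m) (he : ∀ r, (e r).1 ≠ (e r).2)
    (hhub : ∀ k : Fin K, ∃ j, e j = ((0 : Fin (K + 1)), k.succ)) (hμ : ∀ k x, 0 < μ k x) (hμ1 : ∀ k, ∑ u, μ k u = 1)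
    (hM : ∀ k, IsRowStochastic (M k)) (hw0 : ∀ k, 0 ≤ w k) (hw1 : ∑ k, w k = 1) (hwhot : 0 < w 0)
    (ht0 : 0 < t) (ht1 : t < 1) {p γ₀ : ℝ} (hp : 0 < p) (hγ₀ : 0 < γ₀)
    (hdom : ∀ (k : Fin K) (u : S), p * μ k.succ u ≤ μ 0 u)
    (hgap0 : ∀ h : S → ℝ, γ₀ * lawVariance (μ 0) h ≤ dirichletForm (μ 0) (M 0) h)
    (f : (Fin (K + 1) → S) → ℝ) {C : ℝ} (hC0 : 0 ≤ C) (hC1 : C * (6 * m) ≤ p * t)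
    (hC2 : C * (2 * (p + 6 * K)) ≤ p * γ₀ * ((1 - t) * w 0)) :
    C * lawVariance (tensorFun μ) f
      ≤ dirichletForm (tensorFun μ) (fun x y : Fin (K + 1) → S =>
          t * ptGraphSwap μ e (fun _ : Fin m => Equiv.refl S) x y + (1 - t) * prodKernel w M x y) f := by
  have hmpos : (0 : ℝ) < m := Nat.cast_pos.mpr (by omega)
  have hGS0 : ∀ x y, 0 ≤ ptGraphSwap μ e (fun _ : Fin m => Equiv.refl S) x y := (ptGraphSwap_isRowStochastic hμ).1
  have hP0 := (weightedScheme_isRowStochastic (t := t) (w := w) (ptGraphSwap_isRowStochastic (e := e)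
    (φ := fun _ : Fin m => Equiv.refl S) hμ) hM hw0 hw1 ht0.le ht1.le).1
  refine starConveyor_poincare (ν := μ) (Q := fun x y : Fin (K + 1) → S =>
      t * ptGraphSwap μ e (fun _ : Fin m => Equiv.refl S) x y + (1 - t) * prodKernel w M x y) (Q₀ := M 0)
    hμ hμ1 hp hdom (by positivity : 0 < t / m) hγ₀ (mul_pos (by linarith) hwhot : (0 : ℝ) < (1 - t) * w 0) hP0
    ?_ hgap0 ?_ f hC0 ?_ ?_
  · intro x k hx
    obtain ⟨j, hj⟩ := hhub k
    exact whub_swap_flow_ge e he hμ hM hw0 hw1 ht0.le ht1.le x hj hx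
  · intro x v hv
    exact whub_hot_flow_ge (M := M) (w := w) hGS0 hμ ht0.le x hv
  · rw [show p * (t / m) = p * t / m by ring, le_div_iff₀ hmpos]
    calc C * 6 * m = C * (6 * m) := by ring
      _ ≤ p * t := hC1
  · exact hC2

/-- **THE ONE-SIDED HUB FLOOR: `Gap(P) ≥ p·min{t/(6m), γ₀(1−t)w_0/(14K)}`** (`K ≥ 1`, `p ≤ 1`, `|S| ≥ 2`, `0 < t < 1`,
cold updates arbitrary `μ_k`-reversible). [ours] -/
theorem oneSidedHub_spectralGap_ge [Nontrivial S] (hK : 1 ≤ K) (hm : 1 ≤ m) (he : ∀ r, (e r).1 ≠ (e r).2)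
    (hhub : ∀ k : Fin K, ∃ j, e j = ((0 : Fin (K + 1)), k.succ)) (hμ : ∀ k x, 0 < μ k x) (hμ1 : ∀ k, ∑ u, μ k u = 1)
    (hM : ∀ k, IsRowStochastic (M k)) (hMrev : ∀ k, DetailedBalance (μ k) (M k)) (hw0 : ∀ k, 0 ≤ w k)
    (hw1 : ∑ k, w k = 1) (hwhot : 0 < w 0) (ht0 : 0 < t) (ht1 : t < 1) {p γ₀ : ℝ} (hp : 0 < p) (hp1 : p ≤ 1)
    (hγ₀ : 0 < γ₀) (hdom : ∀ (k : Fin K) (u : S), p * μ k.succ u ≤ μ 0 u)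
    (hgap0 : ∀ h : S → ℝ, γ₀ * lawVariance (μ 0) h ≤ dirichletForm (μ 0) (M 0) h) :
    p * min (t / (6 * m)) (γ₀ * (1 - t) * w 0 / (14 * K))
      ≤ spectralGap (tensorFun μ) (fun x y : Fin (K + 1) → S =>
          t * ptGraphSwap μ e (fun _ : Fin m => Equiv.refl S) x y + (1 - t) * prodKernel w M x y) := by
  have hKr : (1 : ℝ) ≤ K := by exact_mod_cast hK
  have hmpos : (0 : ℝ) < m := Nat.cast_pos.mpr (by omega)
  have h1t : 0 < 1 - t := by linarith
  set m₀ := min (t / (6 * m)) (γ₀ * (1 - t) * w 0 / (14 * K)) with hm₀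
  refine le_spectralGap_of_poincare (tensorFun_pos hμ) (sum_tensorFun_eq_one μ hμ1)
    (weightedScheme_isRowStochastic (ptGraphSwap_isRowStochastic hμ) hM hw0 hw1 ht0.le ht1.le)
    (weightedScheme_detailedBalance (ptGraphSwap_detailedBalance hμ) hMrev t) fun f => ?_
  refine oneSidedHub_poincare hm he hhub hμ hμ1 hM hw0 hw1 hwhot ht0 ht1 hp hγ₀ hdom hgap0 f
    (mul_nonneg hp.le (le_min (by positivity) (by positivity))) ?_ ?_
  · have h1 : m₀ ≤ t / (6 * m) := min_le_left _ _
    calc p * m₀ * (6 * m) ≤ p * (t / (6 * m)) * (6 * m) :=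
          mul_le_mul_of_nonneg_right (mul_le_mul_of_nonneg_left h1 hp.le) (by positivity)
      _ = p * t := by field_simp
  · have h2 : m₀ ≤ γ₀ * (1 - t) * w 0 / (14 * K) := min_le_right _ _
    have h3 : 2 * (p + 6 * (K : ℝ)) ≤ 14 * K := by nlinarith
    calc p * m₀ * (2 * (p + 6 * K)) ≤ p * (γ₀ * (1 - t) * w 0 / (14 * K)) * (14 * K) := by
          have := mul_le_mul h2 h3 (by positivity) (by positivity)
          nlinarith
      _ = p * γ₀ * ((1 - t) * w 0) := by field_simp

/-! ## §2 The hot-only star: the linear law, one-sided -/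

/-- **THE ONE-SIDED LINEAR LAW, TWO-SIDED IN `K`:** the star with every update on the hot replica (`w = 𝟙_{k=0}`), hot
Poincaré constant `γ₀`, one-sided domination `p·μ_{k+1} ≤ μ_0`, and a sector `A` with `μ_k(A)μ_k(Aᶜ) ≥ v > 0` at the
cold levels: `p·min{t, γ₀(1−t)}/(14K) ≤ Gap(P) ≤ t·min{μ_0(A), μ_0(Aᶜ)}/(K·v)`. [ours] -/
theorem oneSidedHotOnlyStar_spectralGap_two_sided [Nontrivial S] (hK : 1 ≤ K) (hμ : ∀ k x, 0 < μ k x)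
    (hμ1 : ∀ k, ∑ u, μ k u = 1) (hM : ∀ k, IsRowStochastic (M k)) (hMrev : ∀ k, DetailedBalance (μ k) (M k))
    (ht0 : 0 < t) (ht1 : t < 1) {p γ₀ : ℝ} (hp : 0 < p) (hp1 : p ≤ 1) (hγ₀ : 0 < γ₀)
    (hdom : ∀ (k : Fin K) (u : S), p * μ k.succ u ≤ μ 0 u)
    (hgap0 : ∀ h : S → ℝ, γ₀ * lawVariance (μ 0) h ≤ dirichletForm (μ 0) (M 0) h) {A : Finset S} {v : ℝ}
    (hvpos : 0 < v) (hv : ∀ k : Fin (K + 1), k ≠ 0 → v ≤ (∑ u ∈ A, μ k u) * ∑ u ∈ Aᶜ, μ k u) :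
    p * min t (γ₀ * (1 - t)) / (14 * K)
        ≤ spectralGap (tensorFun μ) (fun x y : Fin (K + 1) → S =>
            t * ptGraphSwap μ (fun k : Fin K => ((0 : Fin (K + 1)), k.succ)) (fun _ : Fin K => Equiv.refl S) x y
              + (1 - t) * prodKernel (fun k : Fin (K + 1) => if k = 0 then (1 : ℝ) else 0) M x y)
      ∧ spectralGap (tensorFun μ) (fun x y : Fin (K + 1) → S =>
            t * ptGraphSwap μ (fun k : Fin K => ((0 : Fin (K + 1)), k.succ)) (fun _ : Fin K => Equiv.refl S) x y
              + (1 - t) * prodKernel (fun k : Fin (K + 1) => if k = 0 then (1 : ℝ) else 0) M x y)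
          ≤ t * min (∑ u ∈ A, μ 0 u) (∑ u ∈ Aᶜ, μ 0 u) / (K * v) := by
  have hKr : (1 : ℝ) ≤ K := by exact_mod_cast hK
  have hKpos : (0 : ℝ) < K := by linarith
  have h1t : 0 < 1 - t := by linarith
  set e : Fin K → Fin (K + 1) × Fin (K + 1) := fun k => ((0 : Fin (K + 1)), k.succ) with he_def
  have he : ∀ j, (e j).1 ≠ (e j).2 := fun k => (Fin.succ_ne_zero k).symm
  have hw0 : ∀ k : Fin (K + 1), 0 ≤ (if k = 0 then (1 : ℝ) else 0) := fun k => by positivity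
  refine ⟨?_, ?_⟩
  · have h := oneSidedHub_spectralGap_ge (e := e) (w := fun k : Fin (K + 1) => if k = 0 then (1 : ℝ) else 0) hK hK he
      (fun k => ⟨k, rfl⟩) hμ hμ1 hM hMrev hw0 hotOnlyWeight_sum (by simp) ht0 ht1 hp hp1 hγ₀ hdom hgap0
    simp only [if_true, mul_one] at h
    refine le_trans ?_ h
    rw [show p * min t (γ₀ * (1 - t)) / (14 * K) = p * (min t (γ₀ * (1 - t)) / (14 * K)) by ring]
    refine mul_le_mul_of_nonneg_left (le_min ?_ ?_) hp.le
    · calc min t (γ₀ * (1 - t)) / (14 * K) ≤ t / (14 * K) :=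
            div_le_div_of_nonneg_right (min_le_left _ _) (by positivity)
        _ ≤ t / (6 * K) := div_le_div_of_nonneg_left ht0.le (by positivity) (by nlinarith)
    · exact div_le_div_of_nonneg_right (min_le_right _ _) (by positivity)
  · have hQ := ptGraphSwap_isRowStochastic (e := e) (φ := fun _ : Fin K => Equiv.refl S) hμ
    have hQrev := ptGraphSwap_detailedBalance (e := e) (φ := fun _ : Fin K => Equiv.refl S) hμ
    have hQA := ptGraphSwap_one_sectorCount_eq (e := e) he hμ A
    have hVge := coldSectorMass_ge (μ := μ) (A := A) hv
    have h := handover_spectralGap_le (w := fun k : Fin (K + 1) => if k = 0 then (1 : ℝ) else 0) hμ hμ1 hM hMrev hw0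
      hotOnlyWeight_sum ht0.le ht1.le hQ hQrev hQA (lt_of_lt_of_le (mul_pos hKpos hvpos) hVge)
    have hU0 : ∑ k : Fin (K + 1), (if k = 0 then (1 : ℝ) else 0)
        * (if k = 0 then (0 : ℝ) else edgeMeasure (μ k) (M k) A Aᶜ) = 0 :=
      Finset.sum_eq_zero fun k _ => by by_cases hk : k = 0 <;> simp [hk]
    rw [hU0, mul_zero, add_zero] at h
    have hη0 : 0 ≤ t * edgeMeasure (tensorFun μ) (ptGraphSwap μ e fun _ : Fin K => Equiv.refl S)
        (univ.filter (fun x : Fin (K + 1) → S => x 0 ∈ A)) (univ.filter (fun x : Fin (K + 1) → S => x 0 ∈ A))ᶜ :=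
      mul_nonneg ht0.le (edgeMeasure_nonneg (fun x => (tensorFun_pos hμ x).le) hQ.1 _ _)
    refine (h.trans (div_le_div_of_nonneg_left hη0 (by positivity) hVge)).trans ?_
    refine div_le_div_of_nonneg_right (mul_le_mul_of_nonneg_left (le_min ?_ ?_) ht0.le) (by positivity)
    · exact handoverFlow_le_hot hμ hμ1 hQ A
    · exact handoverFlow_le_hot_compl hμ hμ1 hQ hQrev A

/-! ## §3 Maps on the hub edges: transported domination, sector-reweighted transports -/

variable (φ : Fin K → Equiv.Perm S)

/-- **THE ONE-SIDED FLOOR FOR THE MAP-ASSISTED STAR:** under TRANSPORTED domination `p·μ_{k+1}(φ_k u) ≤ μ_0(u)`,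
`Gap(P^φ) ≥ p·min{t/(6K), γ₀(1−t)w_0/(14K)}` (any weights with `w_0 > 0`; cold updates arbitrary). [ours] -/
theorem oneSidedFlowStar_spectralGap_ge [Nontrivial S] (hK : 1 ≤ K) (hμ : ∀ k x, 0 < μ k x)
    (hμ1 : ∀ k, ∑ u, μ k u = 1) (hM : ∀ k, IsRowStochastic (M k)) (hMrev : ∀ k, DetailedBalance (μ k) (M k))
    (hw0 : ∀ k, 0 ≤ w k) (hw1 : ∑ k, w k = 1) (hwhot : 0 < w 0) (ht0 : 0 < t) (ht1 : t < 1) {p γ₀ : ℝ}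
    (hp : 0 < p) (hp1 : p ≤ 1) (hγ₀ : 0 < γ₀) (hdom : ∀ (k : Fin K) (u : S), p * μ k.succ (φ k u) ≤ μ 0 u)
    (hgap0 : ∀ h : S → ℝ, γ₀ * lawVariance (μ 0) h ≤ dirichletForm (μ 0) (M 0) h) :
    p * min (t / (6 * K)) (γ₀ * (1 - t) * w 0 / (14 * K))
      ≤ spectralGap (tensorFun μ) (fun x y : Fin (K + 1) → S =>
          t * ptGraphSwap μ (fun k : Fin K => ((0 : Fin (K + 1)), k.succ)) φ x y + (1 - t) * prodKernel w M x y) := by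
  rw [flowStar_spectralGap_eq φ hμ t w]
  set L : Fin (K + 1) → Equiv.Perm S := Fin.cons (Equiv.refl S) (fun k => (φ k).symm) with hL
  have hL0 : ∀ u, (L 0).symm u = u := fun u => by rw [hL, starLevel_zero]; rfl
  have hLs : ∀ (k : Fin K) (u : S), (L k.succ).symm u = φ k u := fun k u => by
    rw [hL, starLevel_succ, Equiv.symm_symm]
  have hν0 : (fun u => μ 0 ((L 0).symm u)) = μ 0 := funext fun u => by rw [hL0]
  have hM0 : (fun u v => M 0 ((L 0).symm u) ((L 0).symm v)) = M 0 := funext fun u => funext fun v => by rw [hL0, hL0]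
  have h := oneSidedHub_spectralGap_ge (μ := fun i u => μ i ((L i).symm u))
    (M := fun i u v => M i ((L i).symm u) ((L i).symm v)) (e := fun k : Fin K => ((0 : Fin (K + 1)), k.succ))
    (w := w) hK hK (fun k => (Fin.succ_ne_zero k).symm) (fun k => ⟨k, rfl⟩) (fun k u => hμ k _)
    (fun k => by rw [Equiv.sum_comp (L k).symm (μ k)]; exact hμ1 k) (fun k => ⟨fun u v => (hM k).1 _ _, fun u => ?_⟩)
    (fun k u v => hMrev k _ _) hw0 hw1 hwhot ht0 ht1 hp hp1 hγ₀ (fun k u => ?_) ?_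
  · simpa using h
  · simpa using (Equiv.sum_comp (L k).symm (fun v => M k ((L k).symm u) v)).trans ((hM k).2 _)
  · simp only [hL0, hLs]; exact hdom k u
  · intro h
    have e1 : lawVariance (fun u => μ 0 ((L 0).symm u)) h = lawVariance (μ 0) h := by rw [hν0]
    have e2 : dirichletForm (fun u => μ 0 ((L 0).symm u)) (fun u v => M 0 ((L 0).symm u) ((L 0).symm v)) h
        = dirichletForm (μ 0) (M 0) h := by rw [hν0, hM0]
    rw [e1, e2]; exact hgap0 h

/-- **SECTOR-REWEIGHTED TRANSPORTS, HOT-ONLY UPDATES: THE LINEAR LAW ACROSS A ONE-SIDED SECTOR-WEIGHT BARRIER** — if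
each map carries the hot law onto the cold law up to a reweighting by SECTOR, `μ_{k+1}(φ_k u) = r_k(mode u)·μ_0(u)`,
with reweighting factors `p·r_k(j) ≤ 1` (every sector keeps at the hot level at least the fraction `p` of its cold
weight; it may be arbitrarily heavier there), and every update is spent on the hot replica:
`Gap(P^φ) ≥ p·min{t, γ₀(1−t)}/(14K)`. [ours] -/
theorem flowStarReweighted_spectralGap_ge_linear [Nontrivial S] {mode : S → J} (r : Fin K → J → ℝ) (hK : 1 ≤ K)
    (hμ : ∀ k x, 0 < μ k x) (hμ1 : ∀ k, ∑ u, μ k u = 1) (hM : ∀ k, IsRowStochastic (M k))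
    (hMrev : ∀ k, DetailedBalance (μ k) (M k)) (ht0 : 0 < t) (ht1 : t < 1) {p γ₀ : ℝ} (hp : 0 < p) (hp1 : p ≤ 1)
    (hγ₀ : 0 < γ₀) (hrew : ∀ (k : Fin K) (u : S), μ k.succ (φ k u) = r k (mode u) * μ 0 u)
    (hr : ∀ (k : Fin K) (j : J), p * r k j ≤ 1)
    (hgap0 : ∀ h : S → ℝ, γ₀ * lawVariance (μ 0) h ≤ dirichletForm (μ 0) (M 0) h) :
    p * min t (γ₀ * (1 - t)) / (14 * K)
      ≤ spectralGap (tensorFun μ) (fun x y : Fin (K + 1) → S =>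
          t * ptGraphSwap μ (fun k : Fin K => ((0 : Fin (K + 1)), k.succ)) φ x y
            + (1 - t) * prodKernel (fun k : Fin (K + 1) => if k = 0 then (1 : ℝ) else 0) M x y) := by
  have hKr : (1 : ℝ) ≤ K := by exact_mod_cast hK
  have hw0 : ∀ k : Fin (K + 1), 0 ≤ (if k = 0 then (1 : ℝ) else 0) := fun k => by positivity
  have hdom : ∀ (k : Fin K) (u : S), p * μ k.succ (φ k u) ≤ μ 0 u := fun k u => by
    rw [hrew k u]
    calc p * (r k (mode u) * μ 0 u) = (p * r k (mode u)) * μ 0 u := by ring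
      _ ≤ 1 * μ 0 u := mul_le_mul_of_nonneg_right (hr k (mode u)) (hμ 0 u).le
      _ = μ 0 u := one_mul _
  have h := oneSidedFlowStar_spectralGap_ge (M := M) (w := fun k : Fin (K + 1) => if k = 0 then (1 : ℝ) else 0) φ hK
    hμ hμ1 hM hMrev hw0 hotOnlyWeight_sum (by simp) ht0 ht1 hp hp1 hγ₀ hdom hgap0
  simp only [if_true, mul_one] at h
  refine le_trans ?_ h
  rw [show p * min t (γ₀ * (1 - t)) / (14 * K) = p * (min t (γ₀ * (1 - t)) / (14 * K)) by ring]
  refine mul_le_mul_of_nonneg_left (le_min ?_ ?_) hp.le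
  · calc min t (γ₀ * (1 - t)) / (14 * K) ≤ t / (14 * K) := div_le_div_of_nonneg_right (min_le_left _ _) (by positivity)
      _ ≤ t / (6 * K) := div_le_div_of_nonneg_left ht0.le (by positivity) (by nlinarith)
  · exact div_le_div_of_nonneg_right (min_le_right _ _) (by positivity)

/-- **EVERY OBSERVABLE under sector-reweighted transports** (hot update irreducible with Poincaré constant `γ₀`,
hot-only updates): `τ_int(g) ≤ 14K/(p·min{t, γ₀(1−t)}) − ½`. [ours] -/
theorem flowStarReweighted_tauInt_le [Nontrivial S] {mode : S → J} (r : Fin K → J → ℝ) (hK : 1 ≤ K)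
    (hμ : ∀ k x, 0 < μ k x) (hμ1 : ∀ k, ∑ u, μ k u = 1) (hM : ∀ k, IsRowStochastic (M k))
    (hMrev : ∀ k, DetailedBalance (μ k) (M k)) (hM0 : IsIrreducible (M 0)) (ht0 : 0 < t) (ht1 : t < 1)
    {p γ₀ : ℝ} (hp : 0 < p) (hp1 : p ≤ 1) (hγ₀ : 0 < γ₀)
    (hrew : ∀ (k : Fin K) (u : S), μ k.succ (φ k u) = r k (mode u) * μ 0 u) (hr : ∀ (k : Fin K) (j : J), p * r k j ≤ 1)
    (hgap0 : ∀ h : S → ℝ, γ₀ * lawVariance (μ 0) h ≤ dirichletForm (μ 0) (M 0) h)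
    {g : (Fin (K + 1) → S) → ℝ} (hg : 0 < lawVariance (tensorFun μ) g) :
    asympVar g (tensorFun μ) (fun x y : Fin (K + 1) → S =>
        t * ptGraphSwap μ (fun k : Fin K => ((0 : Fin (K + 1)), k.succ)) φ x y
          + (1 - t) * prodKernel (fun k : Fin (K + 1) => if k = 0 then (1 : ℝ) else 0) M x y)
      / (2 * lawVariance (tensorFun μ) g) ≤ 14 * K / (p * min t (γ₀ * (1 - t))) - 1 / 2 := by
  have hKpos : (0 : ℝ) < K := Nat.cast_pos.mpr (by omega)
  have hw0 : ∀ k : Fin (K + 1), 0 ≤ (if k = 0 then (1 : ℝ) else 0) := fun k => by positivity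
  have hc0 : 0 < p * min t (γ₀ * (1 - t)) / (14 * K) :=
    div_pos (mul_pos hp (lt_min ht0 (mul_pos hγ₀ (by linarith)))) (by positivity)
  have h := tauInt_le_of_gapFloor (tensorFun_pos hμ) (sum_tensorFun_eq_one μ hμ1)
    (weightedScheme_isRowStochastic (ptGraphSwap_isRowStochastic hμ) hM hw0 hotOnlyWeight_sum ht0.le ht1.le)
    (weightedScheme_detailedBalance (ptGraphSwap_detailedBalance hμ) hMrev t)
    (flowStar_isIrreducible_of_hot φ hμ hM hM0 hw0 hotOnlyWeight_sum (by simp) ht0 ht1) hc0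
    (flowStarReweighted_spectralGap_ge_linear φ r hK hμ hμ1 hM hMrev ht0 ht1 hp hp1 hγ₀ hrew hr hgap0) hg
  rw [one_div_div] at h
  exact h

end OneSided

end Summit.Ventures.LatticeQCDFlow.Scaling

end
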